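import Mathlib
import Literature.AlgebraicGeometry.Resolution.CobordantGame
import Literature.AlgebraicGeometry.Resolution.CobordantChartCoefficients
import Literature.AlgebraicGeometry.Resolution.CobordantChartPlaneSlice
import Literature.AlgebraicGeometry.Resolution.CobordantTupleGame
import Literature.AlgebraicGeometry.Resolution.FormalCoordinateChange
import Summits.ResolutionOfSingularities.ResolutionOfSingularities.Theorems.WeightedInvariantLocalWeightedDropTerminalDoublePointsDimAux
import Summits.ResolutionOfSingularities.ResolutionOfSingularities.Theorems.WeightedInvariantLocalWeightedDropTerminalDoublePointsDimSteps

/-!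
# `WeightedInvariant.LocalWeightedDrop`: the TERMINAL double points `y² + A₀(x₀, …, x_m)` are won — EVERY dimension

Crux item stmt-ResolutionOfSingularities-8899 `LocalWeightedDrop` (route `ResolutionOfSingularities/WeightedInvariant`), skeleton v29,
residual stubs W4|₄ `stub_wildWideApexFourStartsWon` / W4|₅₊ `stub_wildWideApexFiveUpStartsWon` (whose `d = 2` slice is the game on
char-2 monic double points in `≥ 3` old variables, `wildWideApexHigherStartsWon_two_of_monicForms`).  [OURS · L1 W4.3, chain w43,
stub worker 4 (gen 4): the END-GAME of that slice in every dimension — the dimension-generic twin of stub worker 3's S2iT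
`stub_charTwoInseparableTerminalWon` (p479529, `m = 2` old variables only); replaces the role of the «monomial case / small
residual case» of a resolution algorithm for double points; NOT a statement of any manuscript.]

THE RESULT (`terminalDoublePointWon`; every characteristic `p`, every field `k` of characteristic `p`, every number `m + 1 ≥ 1` of
old variables, NO hypothesis on germs in fewer variables or of smaller order).  The monic double point `y² + A₀(x₀, …, x_m)`
(`y = X (Fin.last (m+1))`, `A₀` embedded along `Fin.succAboveEmb (Fin.last (m+1))`) is won in the local weighted resolution game
(`CobordantGame.Won k (m + 2)`) whenever `A₀` is TERMINAL:
* MONOMIAL CASE (`monomialDoublePointWon`): `A₀ = x^μ · U`, `U(0) ≠ 0`, `μ ∉ 2ℕ^{m+1}`;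
* SMALL RESIDUAL CASE (`smallResidualDoublePointWon`): `A₀ = x^{2μ} · g`, `ord g = 1`.

THE STRATEGY never meets a wild point (all weights `≤ 1`) and never leaves `m + 2` variables (tame slices).  Phase 1, `Σ μ`
drops: while some `μ_i ≥ 2` (monomial case) resp. `μ_i ≥ 1` (small residual case) blow up `V(x_i, y)`
(`TerminalDoublePointDim.won_dp_of_curveStep`); the only singular exceptional points lie over `γ = 0`, `c_i ≠ 0`, and the slice there
is `y² + c² · A₀'(ρ_i(c))` — the same shape with `μ_i ↦ μ_i - 2` (resp. `- 1`) transported along the slot cycle `Fin.cycleRange i`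
(`subst_rho_prod_X_pow_mul`; parity, `Σ μ` and `ord g = 1` are transported by `coeff_single_cycleRange_subst_rho`).  Phase 2
(monomial case, all `μ_i ≤ 1`, `K = {i : μ_i = 1} ≠ ∅`): `#K = 1` has a linear term; `#K = 2` is the hyperbolic bottom
`won_dp_X_mul_X_mul` (one move, no singular successor); `#K ≥ 3` — new in dimension `≥ 3`, e.g. `y² + x₀x₁x₂` — is the line step
`won_dp_of_lineStep` (blow up `V(x_a, x_b, y)` through two slots of `K`, brick `won_monic_of_linearBlowup`), after which `#K` and
`Σ μ` drop.  One induction on `Σ μ` runs both phases.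

Corollaries: `terminalDoublePointWon` (the disjunction, S2iT's shape one dimension-parameter up) and `terminalDoublePointWon_four` —
the `N = 4` instance (char-`p` threefold double points `y² + A₀(x₀,x₁,x₂)` with terminal `A₀`), the terminal slice of
W4|₄ ∩ {d = 2}, outside every earlier tree theorem on `CobordantGame.Won k 4`.
-/

set_option linter.dupNamespace false -- mandated namespace of this single-conjunct summit

namespace Summit.ResolutionOfSingularities.ResolutionOfSingularities.Theorems

open Literature.AlgebraicGeometry.Resolution
open Literature.AlgebraicGeometry.Resolution.CobordantGame

namespace TerminalDoublePointDim

open MvPowerSeries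

variable {k : Type} [Field k] {m : ℕ}

/-! ### Exponent bookkeeping -/

/-- Splitting off `x_i^r` from a monomial: `x^μ = x_i^r · x^{μ - r e_i}` (`r ≤ μ_i`). -/
theorem prod_X_pow_eq_mul_prod_update (μ : Fin (m + 1) → ℕ) (i : Fin (m + 1)) (r : ℕ) (h : r ≤ μ i) :
    (∏ l, (X l : MvPowerSeries (Fin (m + 1)) k) ^ μ l) =
      X i ^ r * ∏ l, (X l : MvPowerSeries (Fin (m + 1)) k) ^ Function.update μ i (μ i - r) l := by
  classical
  have hcongr : ∏ l ∈ Finset.univ \ {i}, (X l : MvPowerSeries (Fin (m + 1)) k) ^ Function.update μ i (μ i - r) l =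
      ∏ l ∈ Finset.univ \ {i}, (X l : MvPowerSeries (Fin (m + 1)) k) ^ μ l :=
    Finset.prod_congr rfl (fun l hl => by
      rw [Function.update_of_ne (Finset.notMem_singleton.mp (Finset.mem_sdiff.mp hl).2)])
  rw [Finset.prod_eq_mul_prod_sdiff_singleton_of_mem (Finset.mem_univ i) (fun l => (X l : MvPowerSeries (Fin (m + 1)) k) ^ μ l),
    Finset.prod_eq_mul_prod_sdiff_singleton_of_mem (Finset.mem_univ i)
      (fun l => (X l : MvPowerSeries (Fin (m + 1)) k) ^ Function.update μ i (μ i - r) l),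
    Function.update_self, hcongr, ← mul_assoc, ← pow_add, Nat.add_sub_cancel' h]

/-- `Σ (μ - r e_i) + r = Σ μ` (`r ≤ μ_i`). -/
theorem sum_update_sub_add (μ : Fin (m + 1) → ℕ) (i : Fin (m + 1)) (r : ℕ) (h : r ≤ μ i) :
    ∑ l, Function.update μ i (μ i - r) l + r = ∑ l, μ l := by
  classical
  rw [Finset.sum_update_of_mem (Finset.mem_univ i), Finset.sum_eq_add_sum_sdiff_singleton_of_mem (Finset.mem_univ i) μ]
  omega

/-- `y² + g` with a linear term in `g` is won outright (Refuter has no move). -/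
theorem won_dp_of_coeff_ne_zero {g : MvPowerSeries (Fin (m + 1)) k} (l : Fin (m + 1)) (h : coeff (Finsupp.single l 1) g ≠ 0) :
    CobordantGame.Won k (m + 1 + 1) (X (Fin.last (m + 1)) ^ 2 + rename (Fin.succAboveEmb (Fin.last (m + 1))) g) :=
  (wonBy_zero_of_not_isSingular (Nat.succ_pos _) (not_isSingular_dp_of_coeff_ne_zero l h)).won

/-! ### The monomial case `y² + x^μ · U`, `μ ∉ 2ℕ^{m+1}` -/

/-- THE MONOMIAL CASE, induction on `Σ μ ≤ n` (both phases of the strategy, see the module docstring). -/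
theorem monomialDoublePointWon_aux (p : ℕ) (hp : p.Prime) (k : Type) [Field k] [CharP k p] {m : ℕ} :
    ∀ (n : ℕ) (μ : Fin (m + 1) → ℕ) (U : MvPowerSeries (Fin (m + 1)) k), ∑ l, μ l ≤ n → constantCoeff U ≠ 0 →
      (∃ l, Odd (μ l)) →
      CobordantGame.Won k (m + 1 + 1) (X (Fin.last (m + 1)) ^ 2 +
        rename (Fin.succAboveEmb (Fin.last (m + 1))) ((∏ l, X l ^ μ l) * U)) := by
  classical
  intro n
  induction n with
  | zero =>
    intro μ U hsum _ hodd
    obtain ⟨l₀, ⟨r, hr⟩⟩ := hodd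
    exfalso
    have := Finset.single_le_sum (fun l _ => Nat.zero_le (μ l)) (Finset.mem_univ l₀)
    omega
  | succ n IH =>
    intro μ U hsum hU hodd
    obtain ⟨l₀, hl₀⟩ := hodd
    by_cases h2 : ∃ i, 2 ≤ μ i
    · -- Phase 1: the curve step at a slot with exponent `≥ 2`
      obtain ⟨i, hi⟩ := h2
      set ν : Fin (m + 1) → ℕ := Function.update μ i (μ i - 2) with hν
      have hsumν : ∑ l, ν l + 2 = ∑ l, μ l := sum_update_sub_add μ i 2 hi
      have hνodd : Odd (ν l₀) := by
        rw [hν]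
        by_cases h : l₀ = i
        · subst h
          rw [Function.update_self]
          obtain ⟨r, hr⟩ := hl₀
          exact ⟨r - 1, by omega⟩
        · rw [Function.update_of_ne h]
          exact hl₀
      have hνpos : 0 < ν l₀ := by obtain ⟨r, hr⟩ := hνodd; omega
      refine won_dp_of_curveStep p hp k i _ ((∏ l, X l ^ ν l) * U)
        (by rw [← mul_assoc, ← prod_X_pow_eq_mul_prod_update μ i 2 hi])
        (by rw [map_mul, constantCoeff_prod_X_pow_eq_zero ν hνpos, zero_mul]) ?_
      intro c hc hS
      have hform : C (c ^ 2) * subst (fun l : Fin (m + 1) => if l = i then C c * X 0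
          else (X (Fin.predAbove i l.succ) : MvPowerSeries (Fin (m + 1)) k)) ((∏ l, X l ^ ν l) * U) =
          (∏ l, X l ^ ν ((Fin.cycleRange i).symm l)) * (C (c ^ 2) * (C (c ^ ν i) *
            subst (fun l : Fin (m + 1) => if l = i then C c * X 0
              else (X (Fin.predAbove i l.succ) : MvPowerSeries (Fin (m + 1)) k)) U)) := by
        rw [subst_rho_prod_X_pow_mul]; ring
      rw [hform] at hS ⊢
      refine IH (fun l => ν ((Fin.cycleRange i).symm l)) _ ?_ ?_ ⟨Fin.cycleRange i l₀, ?_⟩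
      · rw [Equiv.sum_comp (Fin.cycleRange i).symm (fun l => ν l)]
        omega
      · rw [map_mul, map_mul, constantCoeff_C, constantCoeff_C, constantCoeff_subst_rho]
        exact mul_ne_zero (pow_ne_zero _ hc) (mul_ne_zero (pow_ne_zero _ hc) hU)
      · simp only [Equiv.symm_apply_apply]
        exact hνodd
    · -- Phase 2: all exponents `≤ 1`
      push Not at h2
      have hμ1 : ∀ l, μ l ≤ 1 := fun l => Nat.lt_succ_iff.mp (h2 l)
      have hl₀1 : μ l₀ = 1 := by have := hμ1 l₀; obtain ⟨r, hr⟩ := hl₀; omega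
      by_cases hK2 : ∃ b, b ≠ l₀ ∧ μ b = 1
      · obtain ⟨b, hbl₀, hb1⟩ := hK2
        by_cases hK3 : ∃ e, e ≠ l₀ ∧ e ≠ b ∧ μ e = 1
        · -- `#K ≥ 3`: the line step
          obtain ⟨e, hel₀, heb, he1⟩ := hK3
          exact won_dp_of_lineStep p hp k μ hμ1 l₀ b e hbl₀.symm hel₀ heb hl₀1 hb1 he1 U hU
            (fun μ' U' hU' hodd' hlt => IH μ' U' (by omega) hU' hodd')
        · -- `K = {l₀, b}`: the hyperbolic bottom
          push Not at hK3
          have hprod : (∏ l, (X l : MvPowerSeries (Fin (m + 1)) k) ^ μ l) = X l₀ * X b := by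
            rw [Finset.prod_eq_mul_prod_sdiff_singleton_of_mem (Finset.mem_univ l₀), hl₀1, pow_one,
              Finset.prod_eq_single_of_mem b (Finset.mem_sdiff.mpr ⟨Finset.mem_univ b, by simpa using hbl₀⟩) ?_, hb1,
              pow_one]
            intro l hl hlb
            have hll₀ : l ≠ l₀ := by simpa using (Finset.mem_sdiff.mp hl).2
            have h0 : μ l = 0 := by have h1 := hμ1 l; have h3 := hK3 l hll₀ hlb; omega
            rw [h0, pow_zero]
          rw [hprod]
          exact won_dp_X_mul_X_mul k l₀ b hbl₀.symm hU
      · -- `K = {l₀}`: a linear term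
        push Not at hK2
        have hprod : (∏ l, (X l : MvPowerSeries (Fin (m + 1)) k) ^ μ l) = X l₀ :=
          prod_X_pow_eq_X_of_single μ l₀ hl₀1 (fun l hl => by have h1 := hμ1 l; have h3 := hK2 l hl; omega)
        rw [hprod]
        exact won_dp_of_coeff_ne_zero l₀ (by rw [coeff_single_X_mul]; exact hU)

/-- THE MONOMIAL CASE `y² + x^μ · U` (`U(0) ≠ 0`, `μ ∉ 2ℕ^{m+1}`) IS WON — every characteristic, every field, every dimension. -/
theorem monomialDoublePointWon (p : ℕ) (hp : p.Prime) (k : Type) [Field k] [CharP k p] {m : ℕ} (μ : Fin (m + 1) → ℕ)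
    (U : MvPowerSeries (Fin (m + 1)) k) (hU : constantCoeff U ≠ 0) (hodd : ¬ ∀ l, 2 ∣ μ l) :
    CobordantGame.Won k (m + 1 + 1) (X (Fin.last (m + 1)) ^ 2 +
      rename (Fin.succAboveEmb (Fin.last (m + 1))) ((∏ l, X l ^ μ l) * U)) := by
  push Not at hodd
  obtain ⟨l, hl⟩ := hodd
  exact monomialDoublePointWon_aux p hp k _ μ U le_rfl hU ⟨l, Nat.odd_iff.mpr (Nat.two_dvd_ne_zero.mp hl)⟩

/-! ### The small residual case `y² + x^{2μ} · g`, `ord g = 1` -/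

/-- THE SMALL RESIDUAL CASE, induction on `Σ μ ≤ n` (curve steps only; `g(0) = 0` and a non-zero linear coefficient of `g` are
transported along `ρ_i(c)`). -/
theorem smallResidualDoublePointWon_aux (p : ℕ) (hp : p.Prime) (k : Type) [Field k] [CharP k p] {m : ℕ} :
    ∀ (n : ℕ) (μ : Fin (m + 1) → ℕ) (g : MvPowerSeries (Fin (m + 1)) k), ∑ l, μ l ≤ n → constantCoeff g = 0 →
      (∃ l, coeff (Finsupp.single l 1) g ≠ 0) →
      CobordantGame.Won k (m + 1 + 1) (X (Fin.last (m + 1)) ^ 2 +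
        rename (Fin.succAboveEmb (Fin.last (m + 1))) ((∏ l, X l ^ (2 * μ l)) * g)) := by
  classical
  -- the bottom `μ = 0`: `y² + g` has a linear term
  have hbase : ∀ (μ : Fin (m + 1) → ℕ) (g : MvPowerSeries (Fin (m + 1)) k), (∀ l, μ l = 0) →
      (∃ l, coeff (Finsupp.single l 1) g ≠ 0) →
      CobordantGame.Won k (m + 1 + 1) (X (Fin.last (m + 1)) ^ 2 +
        rename (Fin.succAboveEmb (Fin.last (m + 1))) ((∏ l, X l ^ (2 * μ l)) * g)) := by
    intro μ g hμ ⟨l, hl⟩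
    rw [Finset.prod_eq_one (fun j _ => by rw [hμ j, mul_zero, pow_zero]), one_mul]
    exact won_dp_of_coeff_ne_zero l hl
  intro n
  induction n with
  | zero =>
    intro μ g hsum _ hlin
    exact hbase μ g (fun l => by
      have := Finset.single_le_sum (fun l _ => Nat.zero_le (μ l)) (Finset.mem_univ l); omega) hlin
  | succ n IH =>
    intro μ g hsum hg0 hlin
    by_cases h1 : ∃ i, 1 ≤ μ i
    · obtain ⟨i, hi⟩ := h1
      set ν : Fin (m + 1) → ℕ := Function.update μ i (μ i - 1) with hν
      have hsumν : ∑ l, ν l + 1 = ∑ l, μ l := sum_update_sub_add μ i 1 hi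
      have hprod : (∏ l, (X l : MvPowerSeries (Fin (m + 1)) k) ^ (2 * μ l)) = X i ^ 2 * ∏ l, X l ^ (2 * ν l) := by
        rw [prod_X_pow_eq_mul_prod_update (fun l => 2 * μ l) i 2 (by omega)]
        congr 2
        funext l
        congr 1
        rw [hν]
        by_cases hl : l = i
        · subst hl
          simp only [Function.update_self]
          omega
        · rw [Function.update_of_ne hl, Function.update_of_ne hl]
      refine won_dp_of_curveStep p hp k i _ ((∏ l, X l ^ (2 * ν l)) * g) (by rw [← mul_assoc, ← hprod])
        (by rw [map_mul, hg0, mul_zero]) ?_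
      intro c hc hS
      obtain ⟨l₁, hl₁⟩ := hlin
      have hform : C (c ^ 2) * subst (fun l : Fin (m + 1) => if l = i then C c * X 0
          else (X (Fin.predAbove i l.succ) : MvPowerSeries (Fin (m + 1)) k)) ((∏ l, X l ^ (2 * ν l)) * g) =
          (∏ l, X l ^ (2 * ν ((Fin.cycleRange i).symm l))) * (C (c ^ 2) * (C (c ^ (2 * ν i)) *
            subst (fun l : Fin (m + 1) => if l = i then C c * X 0
              else (X (Fin.predAbove i l.succ) : MvPowerSeries (Fin (m + 1)) k)) g)) := by
        rw [subst_rho_prod_X_pow_mul]; ring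
      rw [hform] at hS ⊢
      refine IH (fun l => ν ((Fin.cycleRange i).symm l)) _ ?_ ?_ ⟨Fin.cycleRange i l₁, ?_⟩
      · rw [Equiv.sum_comp (Fin.cycleRange i).symm (fun l => ν l)]
        omega
      · rw [map_mul, map_mul, constantCoeff_subst_rho, hg0, mul_zero, mul_zero]
      · rw [coeff_C_mul, coeff_C_mul, coeff_single_cycleRange_subst_rho]
        refine mul_ne_zero (pow_ne_zero _ hc) (mul_ne_zero (pow_ne_zero _ hc) (mul_ne_zero ?_ hl₁))
        split_ifs
        · exact hc
        · exact one_ne_zero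
    · push Not at h1
      exact hbase μ g (fun l => Nat.lt_one_iff.mp (h1 l)) hlin

/-- THE SMALL RESIDUAL CASE `y² + x^{2μ} · g` (`ord g = 1`) IS WON — every characteristic, every field, every dimension. -/
theorem smallResidualDoublePointWon (p : ℕ) (hp : p.Prime) (k : Type) [Field k] [CharP k p] {m : ℕ} (μ : Fin (m + 1) → ℕ)
    (g : MvPowerSeries (Fin (m + 1)) k) (hg : g.order = 1) :
    CobordantGame.Won k (m + 1 + 1) (X (Fin.last (m + 1)) ^ 2 +
      rename (Fin.succAboveEmb (Fin.last (m + 1))) ((∏ l, X l ^ (2 * μ l)) * g)) := by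
  classical
  obtain ⟨⟨d, hd, hdeg⟩, hlow⟩ := MvPowerSeries.order_eq_nat.mp hg
  have hg0 : constantCoeff g = 0 := by
    rw [← coeff_zero_eq_constantCoeff_apply]
    exact hlow 0 (by rw [map_zero]; exact zero_lt_one)
  rcases FormalCoordChange.eq_zero_or_single_of_degree_lt_two d (by rw [hdeg]; norm_num) with rfl | ⟨l, rfl⟩
  · rw [map_zero] at hdeg
    exact absurd hdeg zero_ne_one
  · exact smallResidualDoublePointWon_aux p hp k _ μ g le_rfl hg0 ⟨l, hd⟩

/-! ### The terminal double points, every dimension; the `N = 4` instance -/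

/-- THE TERMINAL DOUBLE POINTS ARE WON (every characteristic `p`, every field of characteristic `p`, every number `m + 1` of old
variables, no hypothesis on other germs): `y² + A₀(x₀, …, x_m)` with `A₀ = x^μ · U` (`U(0) ≠ 0`, `μ ∉ 2ℕ^{m+1}`) or
`A₀ = x^{2μ} · g` (`ord g = 1`).  The dimension-generic twin of S2iT `stub_charTwoInseparableTerminalWon` (`m = 1` there, i.e. two
old variables). [OURS · L1 W4.3 · engine residual W4, `d = 2` end-game] -/
theorem terminalDoublePointWon (p : ℕ) (hp : p.Prime) (k : Type) [Field k] [CharP k p] {m : ℕ}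
    (A₀ : MvPowerSeries (Fin (m + 1)) k)
    (hT : (∃ (μ : Fin (m + 1) → ℕ) (U : MvPowerSeries (Fin (m + 1)) k), MvPowerSeries.constantCoeff U ≠ 0 ∧
        ¬ (∀ l, 2 ∣ μ l) ∧ A₀ = (∏ l, MvPowerSeries.X l ^ μ l) * U) ∨
      (∃ (μ : Fin (m + 1) → ℕ) (g : MvPowerSeries (Fin (m + 1)) k), g.order = 1 ∧
        A₀ = (∏ l, MvPowerSeries.X l ^ (2 * μ l)) * g)) :
    CobordantGame.Won k (m + 1 + 1) (MvPowerSeries.X (Fin.last (m + 1)) ^ 2 +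
      MvPowerSeries.rename (Fin.succAboveEmb (Fin.last (m + 1))) A₀) := by
  rcases hT with ⟨μ, U, hU, hodd, rfl⟩ | ⟨μ, g, hg, rfl⟩
  · exact monomialDoublePointWon p hp k μ U hU hodd
  · exact smallResidualDoublePointWon p hp k μ g hg

end TerminalDoublePointDim

open TerminalDoublePointDim in
/-- **THREEFOLD TERMINAL DOUBLE POINTS ARE WON** (the `N = 4` instance; every characteristic `p`, every field of characteristic
`p`): `y² + A₀(x₀, x₁, x₂)` with `A₀ = x₀^r x₁^s x₂^t · U`, `U(0) ≠ 0`, `(r, s, t) ∉ 2ℕ³`, or `A₀ = (x₀^r x₁^s x₂^t)² · g`,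
`ord g = 1`, is won in `CobordantGame.Won k 4` — the terminal slice of W4|₄ ∩ {d = 2} (char-2 threefold double points,
`wildWideApexFourStartsWon_two_of_monicForms`), unconditionally and outside every earlier tree theorem on `Won k 4`; in
characteristic `2` with `A₀ = x₀x₁x₂` the winning first move is the blow-up of a LINE `V(x_a, x_b, y)`, not of the point and not
of a coordinate surface. [OURS · L1 W4.3 · engine stmt-ResolutionOfSingularities-8899 residual W4] -/
theorem terminalDoublePointWon_four (p : ℕ) (hp : p.Prime) (k : Type) [Field k] [CharP k p]
    (A₀ : MvPowerSeries (Fin 3) k)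
    (hT : (∃ (μ : Fin 3 → ℕ) (U : MvPowerSeries (Fin 3) k), MvPowerSeries.constantCoeff U ≠ 0 ∧
        ¬ (∀ l, 2 ∣ μ l) ∧ A₀ = (∏ l, MvPowerSeries.X l ^ μ l) * U) ∨
      (∃ (μ : Fin 3 → ℕ) (g : MvPowerSeries (Fin 3) k), g.order = 1 ∧
        A₀ = (∏ l, MvPowerSeries.X l ^ (2 * μ l)) * g)) :
    CobordantGame.Won k 4 (MvPowerSeries.X (Fin.last 3) ^ 2 +
      MvPowerSeries.rename (Fin.succAboveEmb (Fin.last 3)) A₀) :=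
  terminalDoublePointWon p hp k (m := 2) A₀ hT

end Summit.ResolutionOfSingularities.ResolutionOfSingularities.Theorems
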